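import Summits.QuantumFields.BalabanUV.T4Continuum.Support.ShellMeasureRootCompositionSU2
import Summits.QuantumFields.BalabanUV.T4Continuum.Support.ShellMeasureWilsonGaugeInvariant

/-!
# `T4Continuum.ShellMeasureWindowInsertion` — (LR)_j STRUCTURAL: END-II with the block's COARSE-PLAQUETTE CO-TEST in
# place of the bond window, at ANY level `j` (cell `pub-balaban`, sub-cell `t4`, spine estimate NE7c (node U5b); NE7c
# ROUND-2 crew `t4-ne7c-formalise-*`, seat leaf-10, row S15 of the owner's claim table
# `t4/b2b-balaban-t4-ne7c-p1/LEAVES-NE7c-P1.md` (RECUT journal l.6161); ADDITIVE — imports END-II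
# `ShellMeasureRootCompositionSU2` (p207698) and the owner's level-0 file `ShellMeasureWilsonGaugeInvariant` (p207446)
# BY NAME and modifies nothing)

HONEST FRAMING.  Finite four-torus programme, rung (B)+1 only — NOT infinite volume, NOT a mass gap, NOT the Clay
problem, NOT summit progress; (B), `BetaPertHyp`, (B^μ) are not consumed.  (M1) for Bałaban's inductively defined
effective measures is NOT PRINTED (GAPS G-ne7cp1-1), asserted by nobody, NOT moved here.  NE7c ⇐ the named binders
(trigger c3); NE7c NOT PRINTED, NOT proved; spine PROVED 0/9 before and after.  STRUCTURAL BOOKKEEPING about END-II's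
window hypothesis — no estimate, 0 sorry, 0 citations, no `def … : Prop` (c2); SM-L1 `hAN`, SM-L2 `hSM`, SM-L3 `hGW`,
SM-L4 `hE`, SM-L6 and the rate keep their status.  HONEST DEPENDENCY (cell): continuum YM on T⁴ ⇐ BetaPertH ∧ nine
spine estimates (0/9 proved); BetaPertH ⇐ (D1) ∧ (D4) ∧ CAP+tail; G-an2-4 gates asym, D1 and NE2/3/4.

THE POINT.  END-II (`ShellMeasureRootCompositionSU2.slotAC_realized_su2_of_levelData`) asks of the realized density the
WINDOW FACTORISATION `hFw : F (fixTo T U₀ (V[Λ := y])) = χ_{Λ,cV,S}(y) · R V y` — at a live level «(LR)_j assumed as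
the window» (swarm referee DV-5).  At level 0 the owner's `ShellMeasureWilsonGaugeInvariant` DERIVED it: a density
supported in the box co-test `boxTest lo hi σ` (all box plaquettes `σ`-small), read after the tree gauge on the axial
comb, has every chart bond in `expWindow 1 S` once `(d − 1)·m·σ ≤ 2S/π` (`ShellMeasureAxialReach`).  Nothing there is
level-0: the chart sits on the bonds of the level-`j` field `V` itself and the box plaquette words of `V` in the chart
are words of exponentials of the chart generators at EVERY `j` (the localized minimiser never enters).  Extracted here:
* §1 `window_of_boxTest_support` — for ANY `F` vanishing off `boxTest lo hi σ`, END-II's `hFw` HOLDS with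
  `T = combBonds lo hi`, `U₀ = 1`, centre `1`, `R V y := F (fixTo (combBonds lo hi) 1 (V[Λ := y]))`.
* §2 `boxTest_contract` — the co-test SURVIVES the contraction `x ↦ c•x` (`0 < c ≤ 1`, `c(1 + δ(1−c)) ≤ 1`) on the
  cube, given (SM)_σ `4(8S)²e^{16S} ≤ δσ` (`ShellMeasureWilsonWords.coreMap_word` on words with unit frozen comb
  letters); hence the co-test indicator read in the chart is CENTRE-MONOTONE (`boxTestInd_le_smul`, END-II's `hJ` shape).
* §3 `slotAC_realized_su2_of_levelData_boxTest` — END-II RE-EXPORTED for `F = 1[boxTest lo hi σ] · G` (`G`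
  gauge-invariant measurable): binders `hFw`, `R`, `hR`, `c` GONE; the dictionary is asked ON THE CUBE ONLY (crew finding
  F-ne7cleaf09-1) and on the co-test support; `Jco` centre-monotone on the cube only; SM-L1…L4 + (SM) + (SM)_σ
  displayed VERBATIM in END-II's shapes; conclusion LITERALLY END-II's
  `SlotAntiConcentration ((fieldMeasure P j SU2).withDensity F) u θ ρ (2(n + βΣ_p L̄_p(d̄_p + 4s̄_p) + B_𝓔)/(1−δ))`.
* §4 `window_of_threshold` — sanity: for EVERY small threshold `σ` the half-side `S := 2((d−1)m+1)σ` meets all side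
  conditions of §3 at once; the pair (reach, (SM)_σ) never conflicts, the window shrinks with the level's threshold.
CONSEQUENCE FOR THE LEDGER.  At a live level the window is IMPLIED by co-tests exactly as at level 0; what remains of
(LR)_j is the [dict] READING «the level-`j` realized density of the slot (own indicator removed) carries — or is
dominated through SM-L6 by one carrying — the block's coarse-plaquette small-field tests at a threshold `σ` with
`(d − 1)·m·σ ≤ 2S/π`» (locator candidates for an S6-type XREAD, NOT cited: the seven groups of characteristic functions
[Balaban1989LargeFieldI] (1.3)–(1.9) p. 178, (1.24) p. 182).  Consumers: the seam S13 and the level-0 specialisation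
S11 may call §3 instead of carrying `hFw`.
WHAT THIS DOES NOT DO.  No instance of SM-L1/L3/L4 at any `j ≥ 1`; (MR)_j untouched; the reading above NOT
discharged; NE7c NOT proved; 0/9 spine.
-/

noncomputable section

open NormedSpace Set Function MeasureTheory Metric

namespace Summit.QuantumFields.BalabanUV.T4Continuum.ShellMeasureWindowInsertion

open scoped ENNReal Matrix.Norms.L2Operator
open Literature.MathematicalPhysics.QuantumFieldTheory.Balaban1983to89
open GaugeField (GaugeInvariant)
open T4ShellMeasure (SlotAntiConcentration)
open T4CubePoincare (cube)
open T4CubeChartGnomonic (SU2)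
open T4CubeChartExp (expJac expFibreChart expWindowDensity expWindowDensity_congr continuous_expFibreChart)
open T4ShellMeasureDet (blockLaw)
open T4TreeGaugeFixing (fixTo measurable_fixTo noClosedLoop_combBonds)
open T4AxialGaugeFixing (combBonds)
open T4AxialGaugeSmallField (boxPlaqs boxBonds)
open ShellMeasureWilsonWords (scale normSum wordExp coreMap_word interpConst_mono normSum_nonneg scale_one)
open ShellMeasureWilsonTrace (wordEval sGen TraceData)
open ShellMeasureWilsonBlock (wilson_dictionary_specialUnitaryGroup)
open ShellMeasureWilsonRealizedSU2 (M₂ plaqWord coe_plaqHol_eq_wordEval wordEval_plaqWord_smul plaqWord_data)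
open ShellMeasureHeadlines (fixTo_updateFinset_of_disjoint)
open ShellMeasureAxialReach (fixTo_comb_eq_one expWindowDensity_eq_one_of_comb)
open ShellMeasureWilsonGaugeInvariant (boxTest mem_boxTest_iff measurableSet_boxTest boxTest_gaugeAct_iff
  exists_gens_of_frozen_eq_one frozen_eq_one_of_mem_plaqWord)
open ShellMeasureScalingSU2 (chartLaw_univ_eq measurable_chartWeight mem_cube_of_chartWeight_ne_zero
  chartWeight_le_smul)
open ShellMeasureWilsonMoving (MLetter mwordEval mdFro sSum lSum)
open ShellMeasureLevelAssembly (classifier weight slotAntiConcentration_of_levelData)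
open ShellMeasureRootCompositionSU2 (slotAC_realized_su2_of_chartAC_gauge)

variable {P : Params} {j : ℕ} [DecidableEq (PBond P j)]

/-! ## §1 The window factorisation from the support of the density in the box co-test -/

section Window

/-- **END-II's `hFw` FROM CO-TEST SUPPORT, ANY LEVEL, ANY DENSITY.**  Box of side `≤ m`, chart bonds
`Λ ⊆ boxBonds` off the comb, `0 ≤ S`, `0 ≤ σ`, `(d − 1)·m·σ ≤ 2S/π`: if `F` vanishes off `boxTest lo hi σ` then
`F (V[comb := 1][Λ := y]) = χ_{Λ,1,S}(1[Λ := y]) · F (V[comb := 1][Λ := y])` — END-II's `hFw` with `T = combBonds`,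
`U₀ = 1`, centre `1`, `R V y := F (fixTo (combBonds lo hi) 1 (V[Λ := y]))` (`expWindowDensity_eq_one_of_comb`). [folklore] -/
theorem window_of_boxTest_support {lo hi : Fin P.d → ℤ} {m : ℕ} (hm : ∀ κ, hi κ ≤ lo κ + m)
    (Λ : Finset (PBond P j)) (hΛbox : ∀ b ∈ Λ, b ∈ boxBonds lo hi) (hΛcomb : Disjoint Λ (combBonds lo hi))
    {S σ : ℝ} (hS : 0 ≤ S) (hσ : 0 ≤ σ) (hrad : ((P.d - 1 : ℕ) : ℝ) * m * σ ≤ 2 * S / Real.pi)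
    {F : GaugeField P j SU2 → ℝ≥0∞} (hFsupp : ∀ U, U ∉ boxTest lo hi σ → F U = 0)
    (V : GaugeField P j SU2) (y : ↥Λ → SU2) :
    F (fixTo (combBonds lo hi) 1 (updateFinset V Λ y)) =
      ENNReal.ofReal (expWindowDensity Λ (1 : GaugeField P j SU2) S
        (updateFinset (1 : GaugeField P j SU2) Λ y)) * F (fixTo (combBonds lo hi) 1 (updateFinset V Λ y)) := by
  by_cases hmem : fixTo (combBonds lo hi) 1 (updateFinset V Λ y) ∈ boxTest lo hi σ
  · have hwin : expWindowDensity Λ 1 S (fixTo (combBonds lo hi) 1 (updateFinset V Λ y)) = 1 :=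
      expWindowDensity_eq_one_of_comb _ (S₀ := boxPlaqs lo hi) subset_rfl hmem hσ hm
        (fixTo_comb_eq_one lo hi _) hS hrad hΛbox
    have hcongr : expWindowDensity Λ 1 S (fixTo (combBonds lo hi) 1 (updateFinset V Λ y)) =
        expWindowDensity Λ (1 : GaugeField P j SU2) S (updateFinset (1 : GaugeField P j SU2) Λ y) :=
      expWindowDensity_congr fun b hb => by
        have hbT : b ∉ combBonds lo hi := Finset.disjoint_left.1 hΛcomb hb
        simp [fixTo, updateFinset, hb, hbT]
    rw [← hcongr, hwin, ENNReal.ofReal_one, one_mul]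
  · rw [hFsupp _ hmem, mul_zero]

end Window

/-! ## §2 The box co-test survives the chart contraction (any level) -/

section Contract

variable (Λ : Finset (PBond P j)) {n : ℕ} (e : ↥Λ × Fin 3 ≃ Fin n)

/-- **BOX PLAQUETTE VARIABLES OF THE COMB-GAUGED SECTION ARE WORDS OF EXPONENTIALS OF THE CHART GENERATORS, at every
level** (comb bonds are unit frozen letters): `dist1 (V[comb := 1][Λ := κ(c•x)])(∂p) = ‖Π exp(c lᵢ) − 1‖`. [folklore] -/
theorem exists_gens_dist1_eq {lo hi : Fin P.d → ℤ} (hΛcomb : Disjoint Λ (combBonds lo hi))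
    (hcov : ∀ b ∈ boxBonds lo hi, b ∉ Λ → b ∈ (combBonds lo hi : Finset (PBond P j)))
    (V : GaugeField P j SU2) (x : Fin n → ℝ) {p : Plaq P j} (hp : p ∈ boxPlaqs lo hi) :
    ∃ l : List M₂, normSum l = sGen (plaqWord Λ e (fixTo (combBonds lo hi) 1 V) x p) ∧
      ∀ c : ℝ, dist1 (GaugeField.plaqHol (fixTo (combBonds lo hi) 1
        (updateFinset V Λ (expFibreChart Λ 1 e (c • x)))) p) = ‖wordExp (scale c l) - 1‖ := by
  have hWcomb : ∀ b ∈ boxBonds lo hi, b ∉ Λ → fixTo (combBonds lo hi) 1 V b = 1 :=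
    fun b hb hbΛ => fixTo_comb_eq_one lo hi V b (hcov b hb hbΛ)
  obtain ⟨l, hl, hlc⟩ :=
    exists_gens_of_frozen_eq_one _ (frozen_eq_one_of_mem_plaqWord Λ e hWcomb x hp)
  refine ⟨l, hl, fun c => ?_⟩
  rw [fixTo_updateFinset_of_disjoint hΛcomb, ← (wilson_dictionary_specialUnitaryGroup _).2,
    coe_plaqHol_eq_wordEval, wordEval_plaqWord_smul, hlc c]

/-- **THE BOX CO-TEST SURVIVES THE CONTRACTION** `x ↦ c•x` on the cube (`0 < S ≤ 1/8`, `σ > 0`, `0 < c ≤ 1`,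
`c(1 + δ(1−c)) ≤ 1`, (SM)_σ `4(8S)²e^{16S} ≤ δσ`; `coreMap_word` with `ρ = 0`, all plaquettes alike). [folklore] -/
theorem boxTest_contract {lo hi : Fin P.d → ℤ} (hΛcomb : Disjoint Λ (combBonds lo hi))
    (hcov : ∀ b ∈ boxBonds lo hi, b ∉ Λ → b ∈ (combBonds lo hi : Finset (PBond P j)))
    {S σ δ c : ℝ} (hS : 0 < S) (hS8 : S ≤ 1 / 8) (hσ : 0 < σ) (hc0 : 0 < c) (hc1 : c ≤ 1)
    (hdepth : c * (1 + δ * (1 - c)) ≤ 1) (hSMσ : 4 * (8 * S) ^ 2 * Real.exp (2 * (8 * S)) ≤ δ * σ)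
    (V : GaugeField P j SU2) {x : Fin n → ℝ} (hx : x ∈ cube n S)
    (hmem : fixTo (combBonds lo hi) 1 (updateFinset V Λ (expFibreChart Λ 1 e x)) ∈ boxTest lo hi σ) :
    fixTo (combBonds lo hi) 1 (updateFinset V Λ (expFibreChart Λ 1 e (c • x))) ∈ boxTest lo hi σ := by
  intro p hp
  obtain ⟨l, hlnorm, hD1⟩ := exists_gens_dist1_eq Λ e hΛcomb hcov V x hp
  rw [hD1 c]
  have h1 : ‖wordExp l - 1‖ < σ := by
    have h := hD1 1
    rw [one_smul, scale_one] at h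
    rw [← h]
    exact hmem p hp
  have hs : normSum l ≤ 8 * S := by
    rw [hlnorm]
    exact (plaqWord_data Λ e hS.le (fixTo (combBonds lo hi) 1 V) hx p).2.1
  have h8S1 : 8 * S ≤ 1 := by linarith
  have hdepth0 : c * (1 + δ * (1 - c)) ≤ 1 - 0 := by rw [sub_zero]; exact hdepth
  have h := coreMap_word l hc0 hc1 (hs.trans h8S1) hσ ((interpConst_mono (normSum_nonneg _) hs).trans hSMσ)
    hdepth0 h1
  simpa using h

/-- every contraction `c = e^{−a}`, `a ≥ 0`, is an admissible depth when `δ ≤ 1`: `c(1 + δ(1−c)) ≤ 1`. [folklore] -/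
theorem exp_neg_depth_le {δ a : ℝ} (hδ1 : δ ≤ 1) (ha : 0 ≤ a) :
    Real.exp (-a) * (1 + δ * (1 - Real.exp (-a))) ≤ 1 := by
  have hc0 : 0 < Real.exp (-a) := Real.exp_pos _
  have hc1 : Real.exp (-a) ≤ 1 := by rw [Real.exp_le_one_iff]; linarith
  nlinarith [mul_nonneg hc0.le (sub_nonneg.2 hc1), sq_nonneg (1 - Real.exp (-a)),
    mul_le_mul_of_nonneg_right hδ1 (mul_nonneg hc0.le (sub_nonneg.2 hc1))]

/-- **THE CO-TEST INDICATOR READ IN THE CHART IS CENTRE-MONOTONE** along `x ↦ e^{−a}x`, `a ≥ 0`, on the cube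
(`δ ≤ 1`, (SM)_σ) — the shape of END-II's kept-co-test binder `hJ`. [folklore] -/
theorem boxTestInd_le_smul {lo hi : Fin P.d → ℤ} (hΛcomb : Disjoint Λ (combBonds lo hi))
    (hcov : ∀ b ∈ boxBonds lo hi, b ∉ Λ → b ∈ (combBonds lo hi : Finset (PBond P j)))
    {S σ δ : ℝ} (hS : 0 < S) (hS8 : S ≤ 1 / 8) (hσ : 0 < σ) (hδ1 : δ ≤ 1)
    (hSMσ : 4 * (8 * S) ^ 2 * Real.exp (2 * (8 * S)) ≤ δ * σ)
    (V : GaugeField P j SU2) {x : Fin n → ℝ} (hx : x ∈ cube n S) {a : ℝ} (ha : 0 ≤ a) :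
    (boxTest lo hi σ).indicator (1 : GaugeField P j SU2 → ℝ≥0∞)
        (fixTo (combBonds lo hi) 1 (updateFinset V Λ (expFibreChart Λ 1 e x))) ≤
      (boxTest lo hi σ).indicator (1 : GaugeField P j SU2 → ℝ≥0∞)
        (fixTo (combBonds lo hi) 1 (updateFinset V Λ (expFibreChart Λ 1 e (Real.exp (-a) • x)))) := by
  by_cases hmem : fixTo (combBonds lo hi) 1 (updateFinset V Λ (expFibreChart Λ 1 e x)) ∈ boxTest lo hi σ
  · have hc1 : Real.exp (-a) ≤ 1 := by rw [Real.exp_le_one_iff]; linarith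
    have hmem' := boxTest_contract Λ e hΛcomb hcov hS hS8 hσ (Real.exp_pos _) hc1 (exp_neg_depth_le hδ1 ha)
      hSMσ V hx hmem
    rw [indicator_of_mem hmem, indicator_of_mem hmem']
    simp only [Pi.one_apply, le_refl]
  · rw [indicator_of_notMem hmem]
    exact bot_le

end Contract

/-! ## §3 END-II with the box co-test instead of the bond window -/

section EndTwo

variable {A : Type*} [NormedRing A] [NormedAlgebra ℂ A] [CompleteSpace A] [NormOneClass A]

omit [DecidableEq (PBond P j)] in
/-- the co-tested density `1[boxTest] · G` is measurable. [folklore] -/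
theorem measurable_boxTestMul {lo hi : Fin P.d → ℤ} (σ : ℝ) {G : GaugeField P j SU2 → ℝ≥0∞}
    (hG : Measurable G) :
    Measurable fun U => (boxTest lo hi σ).indicator (1 : GaugeField P j SU2 → ℝ≥0∞) U * G U :=
  (measurable_one.indicator (measurableSet_boxTest lo hi σ)).mul hG

omit [DecidableEq (PBond P j)] in
/-- … and gauge invariant when `G` is. [folklore] -/
theorem gaugeInvariant_boxTestMul {lo hi : Fin P.d → ℤ} (σ : ℝ) {G : GaugeField P j SU2 → ℝ≥0∞}
    (hGi : GaugeInvariant G) :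
    GaugeInvariant fun U => (boxTest lo hi σ).indicator (1 : GaugeField P j SU2 → ℝ≥0∞) U * G U := by
  intro g U
  have hG := hGi g U
  by_cases hU : U ∈ boxTest lo hi σ
  · have hgU : GaugeField.gaugeAct g U ∈ boxTest lo hi σ := (boxTest_gaugeAct_iff lo hi σ g U).2 hU
    simp only [indicator_of_mem hU, indicator_of_mem hgU, Pi.one_apply, hG]
  · have hgU : GaugeField.gaugeAct g U ∉ boxTest lo hi σ := mt (boxTest_gaugeAct_iff lo hi σ g U).1 hU
    simp only [indicator_of_notMem hU, indicator_of_notMem hgU, zero_mul]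

omit [DecidableEq (PBond P j)] in
/-- **(M1) SEES THE TESTED VARIABLE ONLY ON THE SUPPORT OF THE DENSITY**: `f = 0` off a measurable `K` and `u = u'`
on `K` ⇒ `SlotAntiConcentration (μ.withDensity f) u θ ρ D ↔ … u' …` (the shell events agree a.e.).  Reads END-II's
classifier dictionary ON THE CUBE ONLY (crew finding F-ne7cleaf09-1). [folklore] -/
theorem slotAntiConcentration_congr_of_eqOn {Ω : Type*} [MeasurableSpace Ω] (μ : Measure Ω) {f : Ω → ℝ≥0∞}
    {K : Set Ω} (hK : MeasurableSet K) (hf : ∀ x, x ∉ K → f x = 0) {u u' : Ω → ℝ} (huu' : ∀ x ∈ K, u x = u' x)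
    (θ ρ D : ℝ) :
    SlotAntiConcentration (μ.withDensity f) u θ ρ D ↔ SlotAntiConcentration (μ.withDensity f) u' θ ρ D := by
  have h0 : (μ.withDensity f) Kᶜ = 0 := by
    rw [withDensity_apply _ hK.compl, setLIntegral_congr_fun hK.compl (g := fun _ => 0) hf, lintegral_zero]
  have hae : ∀ᵐ x ∂(μ.withDensity f), x ∈ K := (measure_eq_zero_iff_ae_notMem.1 h0).mono fun x hx => by simpa using hx
  have hE : ({x | θ * (1 - ρ) ≤ u x ∧ u x < θ} : Set Ω) =ᵐ[μ.withDensity f]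
      ({x | θ * (1 - ρ) ≤ u' x ∧ u' x < θ} : Set Ω) := by
    filter_upwards [hae] with x hx
    change (θ * (1 - ρ) ≤ u x ∧ u x < θ) = (θ * (1 - ρ) ≤ u' x ∧ u' x < θ)
    rw [huu' x hx]
  unfold SlotAntiConcentration
  rw [measure_congr hE]

/-- **END-II, CO-TEST FORM — REALIZED (M1) ⇐ SM-L1…L4 + (SM) + (SM)_σ + DICTIONARY, PER SLOT, ANY LEVEL, NO WINDOW
BINDER (`G = SU(2)`).**  Data: NON-WRAPPING box `[lo, hi]` (side `≤ m`); chart bonds `Λ` = box bonds off the axial comb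
(`Λ ⊆ boxBonds`, `Λ ∩ comb = ∅`, `boxBonds ⊆ Λ ∪ comb`), enumeration `e`; half-side `0 < S ≤ 1/8` (`3S² < π²`);
co-test threshold `σ > 0` with the REACH CONDITION `(d − 1)·m·σ ≤ 2S/π`; density `F = 1[boxTest lo hi σ] · G`, `G`
gauge-invariant measurable, per-section finiteness `hfin`; gauge-invariant measurable tested variable `u`.  LEVEL DATA
per exterior `V` EXACTLY END-II's (`hol`, `Gw`, `𝓔`, `W`, kept co-tests `Jco` supported in `W V` and centre-monotone
ON THE CUBE, SM-L1 `hAN`, SM-L3 `hGW` + sizes, SM-L4 `hE`, numbers, SM-L2 `hSM`) plus (SM)_σ `4(8S)²e^{16S} ≤ δσ`.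
DICTIONARY, AT CUBE POINTS ONLY (crew finding F-ne7cleaf09-1; `slotAntiConcentration_congr_of_eqOn`): `hGdict` — on
the co-test support the comb-gauged section of `G` read in the chart about `1` IS `Jco V x · weight Ttr β P_w (Gw V) (𝓔 V) x`;
`hudict` — the tested variable there IS `classifier hPu (hol V) x`.  CONCLUSION (LITERALLY END-II's):
`SlotAntiConcentration ((fieldMeasure P j SU2).withDensity F) u θ ρ (2(n + β Σ_p L̄_p(d̄_p + 4s̄_p) + B_𝓔)/(1−δ))`;
the window factorisation is §1, the co-test rides as a centre-monotone factor by §2.  CONDITIONAL on every displayed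
binder; nothing PRINTED is asserted. [folklore] -/
theorem slotAC_realized_su2_of_levelData_boxTest
    {lo hi : Fin P.d → ℤ} {m : ℕ} (hN : ∀ κ, hi κ - lo κ < P.sitesPerDir j) (hm : ∀ κ, hi κ ≤ lo κ + m)
    (Λ : Finset (PBond P j)) (hΛbox : ∀ b ∈ Λ, b ∈ boxBonds lo hi) (hΛcomb : Disjoint Λ (combBonds lo hi))
    (hcov : ∀ b ∈ boxBonds lo hi, b ∉ Λ → b ∈ (combBonds lo hi : Finset (PBond P j)))
    {n : ℕ} (e : ↥Λ × Fin 3 ≃ Fin n)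
    {S σ : ℝ} (hS : 0 < S) (hS8 : S ≤ 1 / 8) (hSπ : 3 * S ^ 2 < Real.pi ^ 2) (hσ : 0 < σ)
    (hrad : ((P.d - 1 : ℕ) : ℝ) * m * σ ≤ 2 * S / Real.pi)
    -- the realized density: co-test × gauge-invariant factor
    {G : GaugeField P j SU2 → ℝ≥0∞} (hG : Measurable G) (hGi : GaugeInvariant G)
    (hfin : ∀ V, ((blockLaw Λ).withDensity fun y =>
      (boxTest lo hi σ).indicator (1 : GaugeField P j SU2 → ℝ≥0∞) (fixTo (combBonds lo hi) 1 (updateFinset V Λ y)) *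
        G (fixTo (combBonds lo hi) 1 (updateFinset V Λ y))) univ ≠ ∞)
    {u : GaugeField P j SU2 → ℝ} (hu : Measurable u) (hui : GaugeInvariant u)
    -- level data per exterior section (END-II's, verbatim)
    (Ttr : TraceData A) (hNtr : 0 < Ttr.N) {ι κ : Type*} {Pu : Finset ι} (hPu : Pu.Nonempty)
    (hol : GaugeField P j SU2 → ι → (Fin n → ℝ) → A) (hcont : ∀ V, ∀ p ∈ Pu, Continuous (hol V p))
    (Pw : Finset κ) (Gw : GaugeField P j SU2 → κ → (Fin n → ℝ) → A) (𝓔 : GaugeField P j SU2 → (Fin n → ℝ) → ℝ)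
    (W : GaugeField P j SU2 → Set (Fin n → ℝ)) (Jco : GaugeField P j SU2 → (Fin n → ℝ) → ℝ≥0∞)
    {θ δ ρ β Rad H B𝓔 : ℝ} {sw lw dw : κ → ℝ}
    -- DICTIONARY — ON THE CUBE ONLY (crew finding F-ne7cleaf09-1), on the co-test support — and classifier dictionary
    (hGdict : ∀ V, ∀ x ∈ cube n S,
      fixTo (combBonds lo hi) 1 (updateFinset V Λ (expFibreChart Λ 1 e x)) ∈ boxTest lo hi σ →
      G (fixTo (combBonds lo hi) 1 (updateFinset V Λ (expFibreChart Λ 1 e x))) =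
        Jco V x * weight Ttr β Pw (Gw V) (𝓔 V) x)
    (hudict : ∀ V, ∀ x ∈ cube n S, u (fixTo (combBonds lo hi) 1 (updateFinset V Λ (expFibreChart Λ 1 e x))) =
      classifier hPu (hol V) x)
    -- SM-L5/L6: kept co-tests supported in the window, centre-monotone on the cube
    (hJW : ∀ V x, Jco V x ≠ 0 → x ∈ W V)
    (hJ : ∀ V, ∀ x ∈ cube n S, ∀ a : ℝ, 0 ≤ a → Jco V x ≤ Jco V (Real.exp (-a) • x))
    -- SM-L1 (AN-bound)
    (hRad : 1 < Rad)
    (hAN : ∀ V, ∀ x ∈ W V, ∀ p ∈ Pu, ∃ f : ℂ → A, DifferentiableOn ℂ f (ball 0 Rad) ∧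
      (∀ w ∈ ball (0 : ℂ) Rad, ‖f w‖ ≤ H) ∧ f 0 = 0 ∧ ∀ c' : ℝ, 0 ≤ c' → c' ≤ 1 → f (c' : ℂ) = hol V p (c' • x) - 1)
    -- SM-L3 graded sectioned words
    (hGW : ∀ V, ∀ x ∈ W V, ∀ p ∈ Pw, ∃ gw : List (MLetter A × ℝ × ℝ), (∀ y ∈ gw, y.1.Good Ttr.τ y.2.1 y.2.2) ∧
      sSum gw ≤ sw p ∧ lSum gw ≤ lw p ∧ mdFro (gw.map Prod.fst) ≤ dw p ∧
      ∀ c' : ℝ, 0 ≤ c' → c' ≤ 1 → mwordEval c' (gw.map Prod.fst) = Gw V p (c' • x))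
    (hsw1 : ∀ p ∈ Pw, sw p ≤ 1) (hsw0 : ∀ p ∈ Pw, 0 ≤ sw p) (hlw0 : ∀ p ∈ Pw, 0 ≤ lw p)
    (hdw0 : ∀ p ∈ Pw, 0 ≤ dw p)
    -- SM-L4 non-Wilson ray bound
    (hE : ∀ V, ∀ x ∈ W V, ∀ c' : ℝ, 1 / 2 ≤ c' → c' ≤ 1 → 𝓔 V (c' • x) ≤ 𝓔 V x + (1 - c') * B𝓔) (hB𝓔 : 0 ≤ B𝓔)
    -- numbers + SM-L2 (SM) + (SM)_σ
    (hθ : 0 < θ) (hδ0 : 0 ≤ δ) (hδ1 : δ < 1) (hρ0 : 0 ≤ ρ) (hρ : ρ ≤ (1 - δ) / 2) (hβ : 0 ≤ β)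
    (hSM : 36 * H * 1 ^ 2 / (Rad - 1) ^ 2 ≤ δ * θ)
    (hSMσ : 4 * (8 * S) ^ 2 * Real.exp (2 * (8 * S)) ≤ δ * σ) :
    SlotAntiConcentration ((fieldMeasure P j SU2).withDensity fun U =>
        (boxTest lo hi σ).indicator (1 : GaugeField P j SU2 → ℝ≥0∞) U * G U) u θ ρ
      (2 * ((n : ℝ) + (β * ∑ p ∈ Pw, lw p * (dw p + 4 * sw p) + B𝓔)) / (1 - δ)) := by
  -- abbreviations
  set F : GaugeField P j SU2 → ℝ≥0∞ := fun U =>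
    (boxTest lo hi σ).indicator (1 : GaugeField P j SU2 → ℝ≥0∞) U * G U with hFdef
  have hF : Measurable F := measurable_boxTestMul σ hG
  have hFi : GaugeInvariant F := gaugeInvariant_boxTestMul σ hGi
  have hFsupp : ∀ U, U ∉ boxTest lo hi σ → F U = 0 := fun U hU => by
    simp only [hFdef, indicator_of_notMem hU, zero_mul]
  -- the tree: the axial comb of the non-wrapping box is loop-free
  have hT := noClosedLoop_combBonds (P := P) (j := j) hN
  -- §1: the window factorisation with `R V y := F (comb-gauged section)`
  have hFw := window_of_boxTest_support hm Λ hΛbox hΛcomb hS.le hσ.le hrad hFsupp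
  refine slotAC_realized_su2_of_chartAC_gauge hT 1 Λ e hS hSπ (fun _ => (1 : GaugeField P j SU2))
    (R := fun V y => F (fixTo (combBonds lo hi) 1 (updateFinset V Λ y)))
    (fun V => hF.comp ((measurable_fixTo _ 1).comp measurable_updateFinset)) hF hFi hFw hu hui fun V => ?_
  -- the chart law of the section: chart weight × co-test indicator × kept co-tests, times the level weight
  set Jb : (Fin n → ℝ) → ℝ≥0∞ := fun x =>
    (boxTest lo hi σ).indicator (1 : GaugeField P j SU2 → ℝ≥0∞)
      (fixTo (combBonds lo hi) 1 (updateFinset V Λ (expFibreChart Λ 1 e x))) with hJb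
  have hdens : (fun x : Fin n → ℝ => (cube n S).indicator (fun x => ENNReal.ofReal (Real.exp (-expJac Λ e x))) x *
        F (fixTo (combBonds lo hi) 1 (updateFinset V Λ (expFibreChart Λ 1 e x)))) =
      fun x => ((cube n S).indicator (fun x => ENNReal.ofReal (Real.exp (-expJac Λ e x))) x * (Jb x * Jco V x)) *
        weight Ttr β Pw (Gw V) (𝓔 V) x := by
    funext x
    by_cases hxc : x ∈ cube n S
    · by_cases hmem : fixTo (combBonds lo hi) 1 (updateFinset V Λ (expFibreChart Λ 1 e x)) ∈ boxTest lo hi σ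
      · simp only [hFdef, hJb, indicator_of_mem hmem, Pi.one_apply, one_mul, hGdict V x hxc hmem, mul_assoc]
      · simp only [hFdef, hJb, indicator_of_notMem hmem, zero_mul, mul_zero]
    · simp only [indicator_of_notMem hxc, zero_mul]
  rw [hdens]
  -- the tested variable matters only on the cube (the chart law lives there): rename it to the classifier
  refine (slotAntiConcentration_congr_of_eqOn volume (T4CubePoincare.measurableSet_cube' n S)
    (fun x hx => by rw [indicator_of_notMem hx, zero_mul, zero_mul]) (fun x hx => hudict V x hx) θ ρ _).2 ?_
  -- finiteness of the sub-threshold mass of the chart law (from the section's finite mass)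
  have hfin' : ((volume : Measure (Fin n → ℝ)).withDensity fun x =>
      ((cube n S).indicator (fun x => ENNReal.ofReal (Real.exp (-expJac Λ e x))) x * (Jb x * Jco V x)) *
        weight Ttr β Pw (Gw V) (𝓔 V) x) {x | classifier hPu (hol V) x < θ} ≠ ∞ := by
    refine ne_top_of_le_ne_top ?_ (measure_mono (subset_univ _))
    have hRV : Measurable fun y : ↥Λ → SU2 => F (fixTo (combBonds lo hi) 1 (updateFinset V Λ y)) :=
      hF.comp ((measurable_fixTo _ 1).comp measurable_updateFinset)
    rw [← hdens, chartLaw_univ_eq Λ 1 e hS hSπ hRV]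
    have hsec : (fun y => ENNReal.ofReal (expWindowDensity Λ (1 : GaugeField P j SU2) S
          (updateFinset (1 : GaugeField P j SU2) Λ y)) * F (fixTo (combBonds lo hi) 1 (updateFinset V Λ y))) =
        fun y => F (fixTo (combBonds lo hi) 1 (updateFinset V Λ y)) := funext fun y => (hFw V y).symm
    rw [hsec]
    exact hfin V
  -- the one-depth assembly on the chart: window ∩ cube as the window, chart weight × co-test × kept co-tests as J
  have h := slotAntiConcentration_of_levelData (volume : Measure (Fin n → ℝ)) Ttr hNtr hPu (hol V) (hcont V) Pw
    (Gw V) (𝓔 V) (W := W V ∩ cube n S)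
    (J := fun x => (cube n S).indicator (fun x => ENNReal.ofReal (Real.exp (-expJac Λ e x))) x * (Jb x * Jco V x))
    (fun x hx => ⟨hJW V x (right_ne_zero_of_mul (right_ne_zero_of_mul hx)),
      mem_cube_of_chartWeight_ne_zero (left_ne_zero_of_mul hx)⟩)
    (fun x a ha => ?_) hRad
    (fun x hx p hp => hAN V x hx.1 p hp) (fun x hx p hp => hGW V x hx.1 p hp) hsw1 hsw0 hlw0 hdw0
    (fun x hx c' h1 h2 => hE V x hx.1 c' h1 h2) hB𝓔 hθ hδ0 hδ1 hρ0 hρ hβ hSM hfin'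
  · simpa only [Module.finrank_fintype_fun_eq_card, Fintype.card_fin] using h
  · -- centre-monotonicity of J: chart weight (§1 of `ShellMeasureScalingSU2`), co-test (§2), kept co-tests (hJ)
    by_cases hx : x ∈ cube n S
    · exact mul_le_mul' (chartWeight_le_smul e hSπ ha x)
        (mul_le_mul' (boxTestInd_le_smul Λ e hΛcomb hcov hS hS8 hσ hδ1.le hSMσ V hx ha) (hJ V x hx a ha))
    · rw [indicator_of_notMem hx, zero_mul]
      exact bot_le

end EndTwo

/-! ## §4 Sanity: the side conditions of §3 are jointly satisfiable at every threshold scale -/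

section Sanity

/-- **THE WINDOW FROM THE THRESHOLD** (sanity).  For `N ≥ 0` (read `(d − 1)·m`) and ANY threshold
`0 < σ ≤ min (1/(32(N+1))) (δ/(3072(N+1)²))`, `S := 2(N+1)σ` meets every side condition of §3: `0 < S ≤ 1/8`,
`3S² < π²`, reach `N·σ ≤ 2S/π`, (SM)_σ `4(8S)²e^{16S} ≤ δσ` — the pair (reach, (SM)_σ) never conflicts. [folklore] -/
theorem window_of_threshold {N δ σ : ℝ} (hN : 0 ≤ N) (hσ : 0 < σ) (hσ1 : σ ≤ 1 / (32 * (N + 1)))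
    (hσ2 : σ ≤ δ / (3072 * (N + 1) ^ 2)) :
    0 < 2 * (N + 1) * σ ∧ 2 * (N + 1) * σ ≤ 1 / 8 ∧ 3 * (2 * (N + 1) * σ) ^ 2 < Real.pi ^ 2 ∧
      N * σ ≤ 2 * (2 * (N + 1) * σ) / Real.pi ∧
      4 * (8 * (2 * (N + 1) * σ)) ^ 2 * Real.exp (2 * (8 * (2 * (N + 1) * σ))) ≤ δ * σ := by
  have hN1 : 0 < N + 1 := by linarith
  have hS0 : 0 < 2 * (N + 1) * σ := by positivity
  have hS16 : 2 * (N + 1) * σ ≤ 1 / 16 := by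
    calc 2 * (N + 1) * σ ≤ 2 * (N + 1) * (1 / (32 * (N + 1))) := mul_le_mul_of_nonneg_left hσ1 (by positivity)
      _ = 1 / 16 := by field_simp; ring
  refine ⟨hS0, by linarith, by nlinarith [Real.pi_gt_three, hS16, hS0], ?_, ?_⟩
  · -- `Nσ ≤ 4(N+1)σ/π ⟸ πN ≤ 4(N+1)`
    rw [le_div_iff₀ Real.pi_pos]
    nlinarith [Real.pi_lt_four, Real.pi_pos, hN, hσ]
  · -- `4·(16(N+1)σ)²·e^{32(N+1)σ} ≤ 3072(N+1)²σ² ≤ δσ`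
    have hexp : Real.exp (2 * (8 * (2 * (N + 1) * σ))) ≤ 3 := by
      have h1 : 2 * (8 * (2 * (N + 1) * σ)) ≤ 1 := by linarith
      exact (Real.exp_le_exp.2 h1).trans (Real.exp_one_lt_d9.le.trans (by norm_num))
    have hmain : 3072 * (N + 1) ^ 2 * σ ≤ δ := by
      have h := hσ2
      rw [le_div_iff₀ (by positivity)] at h
      linarith
    calc 4 * (8 * (2 * (N + 1) * σ)) ^ 2 * Real.exp (2 * (8 * (2 * (N + 1) * σ)))
        ≤ 4 * (8 * (2 * (N + 1) * σ)) ^ 2 * 3 := by gcongr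
      _ = (3072 * (N + 1) ^ 2 * σ) * σ := by ring
      _ ≤ δ * σ := mul_le_mul_of_nonneg_right hmain hσ.le

end Sanity

end Summit.QuantumFields.BalabanUV.T4Continuum.ShellMeasureWindowInsertion

end
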